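import Mathlib.RingTheory.Regular.Flat
import Mathlib.RingTheory.Flat.FaithfullyFlat.Basic
import Mathlib.RingTheory.KrullDimension.Basic
import Mathlib.RingTheory.LocalRing.MaximalIdeal.Basic
import Mathlib.RingTheory.Noetherian.Basic
import Mathlib.RingTheory.Ideal.Operations
import HarnessLib

/-!
# Weakly regular sequences and the Cohen–Macaulay clause descend along faithfully flat maps

Topic: `Literature/AlgebraicGeometry/Resolution` (input of the projective globalization of
Macaulayfication: the local ring of `Proj R` at `p` is `R_{(p)}`, and `R_{(p)} → R_p` is a flat local
homomorphism with `𝔪_{(p)} R_p` primary to the maximal ideal and `dim R_{(p)} = dim R_p`; so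
Cohen–Macaulayness of the ordinary localization `R_p` — which is what the affine `Ext`-annihilator
ideal controls, `ExtAnnihilatorAffineGlobal.lean` — descends to `R_{(p)}`).

* `IsSMulRegular.of_faithfullyFlat_of_isBaseChange'` — for a faithfully flat `R`-algebra `S` and a
  base change `f : M → N` to `S`, if `x ∈ R` is `N`-regular then it is `M`-regular (converse of
  Mathlib's `IsSMulRegular.of_flat_of_isBaseChange`);
* `IsWeaklyRegular.of_faithfullyFlat_of_isBaseChange'`, `IsWeaklyRegular.of_faithfullyFlat'` —
  the same for weakly regular sequences (converse of `IsWeaklyRegular.of_flat_of_isBaseChange`);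
* `cmClause_of_faithfullyFlat` — **descent of the Cohen–Macaulay clause**: for a faithfully flat
  algebra `A → B` of local rings, `A` Noetherian, with `dim A = dim B` and `rad (𝔪_A B) = 𝔪_B`, if
  every system of parameters of `B` is a weakly regular sequence then so is every system of
  parameters of `A`.

Sources: ascent/descent of regular sequences and of Cohen–Macaulayness along flat local maps is
[Matsumura1987, Thm. 23.3 and its Corollary ("`B` Cohen–Macaulay ⇒ `A` Cohen–Macaulay" for a
flat local homomorphism `A → B`)] / [BrunsHerzog1998, Prop. 1.1.2, Thm. 2.1.7]; here only the
elementary special case `dim A = dim B`, `rad (𝔪_A B) = 𝔪_B` of the descent is treated, by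
reflecting injectivity along the faithfully flat base change.
[cite: Matsumura1987, Thm. 23.3 Cor.; BrunsHerzog1998, Thm. 2.1.7]
-/

noncomputable section

open IsLocalRing Module TensorProduct

universe u v

namespace Literature.AlgebraicGeometry.Resolution

namespace RingTheory.Sequence

open _root_.RingTheory.Sequence

variable {R S M N : Type*} [CommRing R] [CommRing S] [Algebra R S]
  [AddCommGroup M] [Module R M] [AddCommGroup N] [Module R N] [Module S N] [IsScalarTower R S N]
  [Module.FaithfullyFlat R S]

/-- **Regular elements descend along faithfully flat base change**: if `N` is the base change of
`M` to the faithfully flat `R`-algebra `S` and `x ∈ R` is `N`-regular, then `x` is `M`-regular.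
[cite: Matsumura1987, Thm. 23.3 (proof); BrunsHerzog1998, Lemma 1.2.16 (proof)] -/
theorem IsSMulRegular.of_faithfullyFlat_of_isBaseChange' {f : M →ₗ[R] N} (hf : IsBaseChange S f)
    {x : R} (reg : IsSMulRegular N (algebraMap R S x)) : IsSMulRegular M x := by
  have h1 : ∀ z : S ⊗[R] M,
      hf.equiv ((LinearMap.lsmul R M x).lTensor S z) = algebraMap R S x • hf.equiv z := by
    intro z
    induction z using TensorProduct.induction_on with
    | zero => simp
    | tmul s m =>
      simp only [LinearMap.lTensor_tmul, LinearMap.lsmul_apply, IsBaseChange.equiv_tmul,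
        map_smul, algebraMap_smul]
      exact smul_comm s x (f m)
    | add z₁ z₂ h₁ h₂ => simp only [map_add, h₁, h₂, smul_add]
  have key : Function.Injective ((LinearMap.lsmul R M x).lTensor S) := by
    intro z₁ z₂ h
    apply hf.equiv.injective
    apply reg
    change algebraMap R S x • hf.equiv z₁ = algebraMap R S x • hf.equiv z₂
    rw [← h1, ← h1, h]
  exact (Module.FaithfullyFlat.lTensor_injective_iff_injective R S _).mp key

/-- **Weakly regular sequences descend along faithfully flat base change** (converse of
`IsWeaklyRegular.of_flat_of_isBaseChange`). [cite: Matsumura1987, Thm. 23.3 (proof)] -/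
theorem IsWeaklyRegular.of_faithfullyFlat_of_isBaseChange' {f : M →ₗ[R] N}
    (hf : IsBaseChange S f) {rs : List R}
    (reg : IsWeaklyRegular N (rs.map (algebraMap R S))) : IsWeaklyRegular M rs := by
  induction rs generalizing M N with
  | nil => exact IsWeaklyRegular.nil R M
  | cons x _ ih =>
    simp only [List.map_cons, isWeaklyRegular_cons_iff] at reg ⊢
    have e := (QuotSMulTop.algebraMapTensorEquivTensorQuotSMulTop x M S).symm ≪≫ₗ
      QuotSMulTop.congr ((algebraMap R S) x) hf.equiv
    have hg : IsBaseChange S <|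
        e.toLinearMap.restrictScalars R ∘ₗ TensorProduct.mk R S (QuotSMulTop x M) 1 :=
      IsBaseChange.of_equiv e (fun _ ↦ by simp)
    exact ⟨IsSMulRegular.of_faithfullyFlat_of_isBaseChange' hf reg.1, ih hg reg.2⟩

/-- Weakly regular sequences of ring elements descend along faithfully flat algebras.
[cite: Matsumura1987, Thm. 23.3 (proof)] -/
theorem IsWeaklyRegular.of_faithfullyFlat' {rs : List R}
    (reg : IsWeaklyRegular S (rs.map (algebraMap R S))) : IsWeaklyRegular R rs :=
  IsWeaklyRegular.of_faithfullyFlat_of_isBaseChange' (IsBaseChange.linearMap R S) reg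

end RingTheory.Sequence

/-! ## Descent of the Cohen–Macaulay clause -/

section CM

variable {A B : Type u} [CommRing A] [CommRing B] [IsLocalRing A] [IsLocalRing B]
  [IsNoetherianRing A] [Algebra A B] [Module.FaithfullyFlat A B]

omit [IsLocalRing A] [IsLocalRing B] [IsNoetherianRing A] [Module.FaithfullyFlat A B] in
/-- `span (φ ∘ s) = (span s) B`. [folklore] -/
theorem span_range_comp_algebraMap {ι : Type*} (s : ι → A) :
    Ideal.span (Set.range (algebraMap A B ∘ s)) = (Ideal.span (Set.range s)).map (algebraMap A B) := by
  rw [Ideal.map_span, Set.range_comp]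

/-- **Descent of the Cohen–Macaulay clause along a faithfully flat algebra of local rings with
trivial fibre dimension**: `A → B` faithfully flat, `A` Noetherian local, `B` local,
`dim A = dim B`, `rad (𝔪_A B) = 𝔪_B`. If every system of parameters of `B` (a sequence of
length `dim B` generating an ideal with maximal radical) is a weakly regular sequence, then the
same holds for `A`: the image of a system of parameters of `A` is one of `B`, and weakly regular
sequences descend (`IsWeaklyRegular.of_faithfullyFlat'`).
[cite: Matsumura1987, Thm. 23.3 Cor.; BrunsHerzog1998, Thm. 2.1.7] -/
theorem cmClause_of_faithfullyFlat (hdim : ringKrullDim A = ringKrullDim B)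
    (hrad : ((maximalIdeal A).map (algebraMap A B)).radical = maximalIdeal B)
    (hB : ∀ d : ℕ, ringKrullDim B = d → ∀ s : Fin d → B,
      (Ideal.span (Set.range s)).radical.IsMaximal →
        RingTheory.Sequence.IsWeaklyRegular B (List.ofFn s)) :
    ∀ d : ℕ, ringKrullDim A = d → ∀ s : Fin d → A,
      (Ideal.span (Set.range s)).radical.IsMaximal →
        RingTheory.Sequence.IsWeaklyRegular A (List.ofFn s) := by
  intro d hd s hs
  have hradA : (Ideal.span (Set.range s)).radical = maximalIdeal A := IsLocalRing.eq_maximalIdeal hs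
  -- the image of `s` generates an ideal with radical `𝔪_B`
  have hle : (maximalIdeal A).map (algebraMap A B) ≤ maximalIdeal B :=
    hrad ▸ Ideal.le_radical
  have hs' : (Ideal.span (Set.range (algebraMap A B ∘ s))).radical.IsMaximal := by
    rw [span_range_comp_algebraMap]
    suffices h : ((Ideal.span (Set.range s)).map (algebraMap A B)).radical = maximalIdeal B by
      rw [h]; exact IsLocalRing.maximalIdeal.isMaximal B
    apply le_antisymm
    · rw [← (IsLocalRing.maximalIdeal.isMaximal B).isPrime.radical]
      refine Ideal.radical_mono (le_trans (Ideal.map_mono ?_) hle)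
      exact hradA ▸ Ideal.le_radical
    · -- `𝔪_A^N ⊆ (s)` for some `N`, so `(𝔪_A B)^N ⊆ (s)B` and `𝔪_B = rad (𝔪_A B) ⊆ rad ((s)B)`
      obtain ⟨N, hN⟩ := Ideal.exists_pow_le_of_le_radical_of_fg hradA.ge
        (IsNoetherian.noetherian (maximalIdeal A))
      have hN' : maximalIdeal A ^ (N + 1) ≤ Ideal.span (Set.range s) :=
        le_trans (Ideal.pow_le_pow_right (Nat.le_succ N)) hN
      calc maximalIdeal B = ((maximalIdeal A).map (algebraMap A B)).radical := hrad.symm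
        _ = (((maximalIdeal A).map (algebraMap A B)) ^ (N + 1)).radical :=
            (Ideal.radical_pow _ N.succ_ne_zero).symm
        _ ≤ ((Ideal.span (Set.range s)).map (algebraMap A B)).radical := by
            refine Ideal.radical_mono ?_
            rw [← Ideal.map_pow]
            exact Ideal.map_mono hN'
  have hdB : ringKrullDim B = d := hdim ▸ hd
  have hreg := hB d hdB (algebraMap A B ∘ s) hs'
  rw [← List.map_ofFn] at hreg
  exact RingTheory.Sequence.IsWeaklyRegular.of_faithfullyFlat' hreg

end CM

end Literature.AlgebraicGeometry.Resolution

end
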